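import Literature.Analysis.DeBrangesSpaces.DeBranges1986PositivityProofs
import Literature.Analysis.DeBrangesSpaces.ReproducingKernelRealZeros
import HarnessLib

/-!
# de Branges 1986, Theorems 6 and 7 hold as printed (structure functions with real zeros)

LABEL: RH-FREE. Discharges of the named facts `deBranges1986_thm6`, `deBranges1986_thm7`
(`DeBranges1986Positivity.lean`) — CONDITIONAL theorems about a GENERAL structure function whose
positivity hypothesis is REFUTED for `E(z) = ξ(1 − iz)`
(`Literature.Barriers.RiemannHypothesis.ConreyLi2000_HE_holds`). bears_on: B-C/B-P (COLUMN 6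
DBR). WHAT THIS IS NOT: a statement about `ζ` or progress toward RH; nothing here bears on the
truth of RH.

`DeBranges1986PositivityProofs.lean` proves both theorems for every structure function with the
reproducing property `HasReproducing E` and reduces the printed statements to
`∀ E, IsHermiteBiehler E → ShiftLinDep E → HasReproducing E`
(`deBranges1986_thm6_of_forall_hasReproducing`, `deBranges1986_thm7_of_forall_hasReproducing`);
`ReproducingKernelRealZeros.lean` proves the reproducing identity for EVERY Hermite–Biehler
function (`deBrangesInner_deBrangesKernel_of_isHermiteBiehler`), real zeros included. This file
puts the two together: `deBranges1986_thm6_holds`, `deBranges1986_thm7_holds`, plus de Branges'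
strict kernel positivity at admissible zeros and the provable clause of the strict remark for
every structure function. The real-zero clauses of `deBranges1986_strictRemark` ("no zero `w`
with `w` or `w + i` real" under strict positivity, p. 16 l. 17–20, asserted without proof) remain
typed, proved for `E` without real zeros (`deBranges1986_strictRemark_of_noRealZeros`).

## References

* L. de Branges, Bull. AMS 15 (1986) 1–17, Thms 6–7, pp. 14–16 (read) [deBranges1986].
-/

noncomputable section

open scoped Real ComplexConjugate
open _root_.Complex

namespace Literature.Analysis.DeBrangesSpaces

open DeBranges1986

variable {E : ℂ → ℂ}

/-- Every Hermite–Biehler function has the reproducing property (real zeros allowed).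
[cite: deBranges1986, p. 3] -/
theorem hasReproducing_of_isHermiteBiehler (hE : IsHermiteBiehler E) : HasReproducing E :=
  fun _ hF hF2 hFb _ hw => deBrangesInner_deBrangesKernel_of_isHermiteBiehler hE hF hF2 hFb hw

/-- **de Branges 1986, Theorem 6, holds as printed** (structure functions with real zeros
included; no monotonicity hypothesis): under linear dependence of `E(· − i)`, `E♯` and the
positivity condition on the shift domain, every zero `w` with `w, w + i ∉ ℝ` and
`E(w + i) ≠ E(w − i)` is simple and lies on `w̄ = w + i`. [cite: deBranges1986, Theorem 6] -/
theorem deBranges1986_thm6_holds : deBranges1986_thm6 :=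
  deBranges1986_thm6_of_forall_hasReproducing fun _ hE _ => hasReproducing_of_isHermiteBiehler hE

/-- **de Branges 1986, Theorem 7, holds as printed.** [cite: deBranges1986, Theorem 7] -/
theorem deBranges1986_thm7_holds : deBranges1986_thm7 :=
  deBranges1986_thm7_of_forall_hasReproducing fun _ hE _ => hasReproducing_of_isHermiteBiehler hE

/-- de Branges' strict kernel positivity at admissible zeros, for every structure function
(proof of Theorem 6, p. 15 l. 32 – p. 16 l. 16): `Re conj E′(w) E(w + i)/(2πi) > 0` — strictly
stronger than the `≥ 0` of Conrey–Li's Theorem 1 at these zeros. [cite: deBranges1986,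
Theorem 6] -/
theorem re_kernel_pos_of_isAdmissibleZero (hE : IsHermiteBiehler E) (hlin : ShiftLinDep E)
    (hpos : ShiftNonneg E) {w : ℂ} (hw : IsAdmissibleZero E w) :
    0 < (conj (deriv E w) * E (w + I) / (2 * π * I)).re :=
  (deBranges1986_thm6_of_hasReproducing hE (hasReproducing_of_isHermiteBiehler hE) hlin hpos
    hw).2.2

/-- The provable clause of de Branges' strict remark (p. 16 l. 17–20) for every structure
function: strict positivity on the shift domain excludes zeros `w` with `w, w + i ∉ ℝ` and
`E(w + i) = E(w − i)`. [cite: deBranges1986, p. 16] -/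
theorem apply_add_I_ne_of_shiftPos_of_isHermiteBiehler (hE : IsHermiteBiehler E)
    (hlin : ShiftLinDep E) (hpos : ShiftPos E) {w : ℂ} (hw : E w = 0) (h0 : w.im ≠ 0)
    (h1 : (w + I).im ≠ 0) : E (w + I) ≠ E (w - I) :=
  apply_add_I_ne_of_shiftPos hE (hasReproducing_of_isHermiteBiehler hE) hlin hpos hw h0 h1

/-- Under strict positivity every zero `w` of `E` with `w, w + i ∉ ℝ` is admissible, hence simple
and on the line `w̄ = w + i` (every structure function). [cite: deBranges1986, p. 16] -/
theorem zero_simple_on_line_of_shiftPos (hE : IsHermiteBiehler E) (hlin : ShiftLinDep E)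
    (hpos : ShiftPos E) {w : ℂ} (hw : E w = 0) (h0 : w.im ≠ 0) (h1 : (w + I).im ≠ 0) :
    deriv E w ≠ 0 ∧ conj w = w + I :=
  deBranges1986_thm6_holds E hE hlin hpos.shiftNonneg w
    ⟨hw, h0, h1, apply_add_I_ne_of_shiftPos_of_isHermiteBiehler hE hlin hpos hw h0 h1⟩

end Literature.Analysis.DeBrangesSpaces

end
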